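import Summits.QuantumFields.YangMills.Theorems.BalabanUVNodesN15KingModelToronMasslessResolvent
import HarnessLib

/-!
# BalabanUVNodes ∕ N15 — THE KING-MODEL RUNG (PART Ͷ-i): CARTAN TORONS — a constant link field in the MAXIMAL TORUS of `U(n)`, `U(x,μ) = diag(ω^{(1)}_μ, …, ω^{(n)}_μ)`, splits King's
# covariant fine operator on the fibre `ℂⁿ` into `n` ABELIAN TORON OPERATORS (one per colour): `−cΔ_U + m² = blockDiagonal_i (−cΔ_{ω^{(i)}} + m²)`; hence the covariance, the
# determinant and the spectral bottom colour by colour — the gap is the smallest of the `n` holonomy gaps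
# (Track A, DAG node N15 = NE2; FAN-OUT v1.1 §N15 s3 «KING-MODEL RUNG … + what the curved case adds»; count-neutral)

HONEST FRAMING.  Count-neutral (cell `pub-ymgap`, seat `pub-ymgap-dag-n15-e` g44; `--supports stmt-QuantumFields-27247 --as helper` = K3ᴬ, KEY MAP v3).  One finite torus at
fixed spacing; King's `A = 0` model [King1986] is the comparison object; constant link fields with values in a maximal torus (commuting, simultaneously diagonal) — the reading of
the tree's `B5ToronOperators118` header («after a global gauge `g_ν` in one maximal torus the adjoint action on a charged sector is multiplication by a unit complex number `ω_ν`»), here for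
the FUNDAMENTAL (vector) action on `ℂⁿ`: colour `i` sees the abelian toron `ω^{(i)}`.  General constant non-abelian fields that do not commute are NOT flat and are not treated.  NOT
Bałaban's `G_k(U)`; NOT a node discharge; nothing continuum ∕ ℝ⁴ ∕ OS ∕ Clay.

THE RESULTS (`Ω : n → (Fin(d+1) → ℂ)` the colour phases, `cartanLink Ω (x,μ) = diagonal(i ↦ Ω i μ)`; PART Ͱ-a's `covLapF`, PART Ͷ-a's `toronOp`):
* §1 `cartanLink`, `cartanLink_mem_unitaryGroup` (unit phases), ★★★ **`covLapF_cartanLink_eq_blockDiagonal`** — `covLapF K c m² (cartanLink Ω) = blockDiagonal (i ↦ toronOp K c m² (Ω i))`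
  (Mathlib's `Matrix.blockDiagonal` on `T × n`: colour-diagonal, the abelian toron operators on the diagonal);
* §2 consequences by the block-diagonal calculus: `blockDiagonal_inv_of_isUnit`, ★★ **`covLapF_cartanLink_inv`** (the covariance is `blockDiagonal (i ↦ (toronOp (Ω i))⁻¹)` — every
  formula of PARTS Ͷ-b∕Ͷ-e∕Ͷ-f∕Ͷ-g holds colour by colour), `covLapF_cartanLink_inv_apply`, ★ `det_covLapF_cartanLink` (`det = Π_i det toronOp(Ω i)`), ★★ `det_covLapF_cartanLink_eq_prod`
  (`= Π_iΠ_q lapSymTw(φ_i, q)` for `Ω i = e^{iφ_i}`, `c ≥ 0`);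
* §3 THE FORM AND THE GAP: `star_dotProduct_blockDiagonal_mulVec` (`v^*·blockDiagonal(M)·v = Σ_i v_i^*M_iv_i`), ★★★ **`form_covLapF_cartanLink_ge`** — for reduced angles `θ_i`
  (`Ω i = e^{iθ_i∕K}`, `c ≥ 0`) and any `λ ≤ m² + holonomyGap(θ_i)` for all colours, `λ·Σ_{x,i}|v(x,i)|² ≤ Re(v^*(−cΔ_U+m²)v)`: THE SPECTRAL BOTTOM OF THE CARTAN TORON IS THE SMALLEST
  COLOUR GAP `m² + min_i 2cΣ_μ(1 − cos(θ_{i,μ}∕K_μ))`, ★★ `form_covLapF_cartanLink_colour` (attained: a field constant in colour `i₀` and zero elsewhere has `Re(v^*Mv) = (m² +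
  holonomyGap(θ_{i₀}))·Σ|v|²`).

PRIOR TREE ART (by name, not restated): Ͱ-a (`covLapF`, `covLapF_apply`), Ͷ-a (`toronOp`, `toronOp_apply`, `toronLink`, `toronOp_mulVec_chi`∕`form_toronOp_chi`), Ͷ-b (`det_toronOp_eq_ofReal_prod`),
Ͷ-d (`holonomyGap`, `redPhase`, `form_toronOp_ge_holonomyGap`, `form_toronOp_const`, `chi_zero_eq_one`), Mathlib (`Matrix.blockDiagonal`, `blockDiagonal_apply`, `blockDiagonal_mul`,
`blockDiagonal_one`, `det_blockDiagonal`).  Dedup (rg at filing): basename 0 files; needles `cartanLink|covLapF_cartanLink|blockDiagonal_inv_of_isUnit|star_dotProduct_blockDiagonal_mulVec` 0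
tree files.  Locators: [Balaban1985BackgroundPropagators] (3.3) p.391, (3.23) p.394; [Balaban1984PropagatorsI] (1.31) p.23; [King1986] (4.4) p.670; [tHooft1979Flux] NPB 153 (notion only).
0 `sorry`, 1 `def` (`cartanLink`).
-/

noncomputable section

open scoped BigOperators ComplexConjugate ComplexOrder
open Finset Matrix Complex

namespace Summit.QuantumFields.YangMills.BalabanUVNodes.N15KingModelRung.Toron

open Literature.MathematicalPhysics.QuantumFieldTheory.Balaban1983to89.B5Prop11Plancherel
open Literature.MathematicalPhysics.QuantumFieldTheory.Balaban1983to89.B5ToronMomentum161 (twistOf)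
open Summit.QuantumFields.YangMills.BalabanUVNodes.N15KingModelRung.Covariant (covLapF covLapF_apply)

variable {d : ℕ} (K : Fin (d + 1) → ℕ) {n : Type*} [DecidableEq n]

/-! ## §1 The Cartan link field and the colour splitting -/
section Split

/-- THE CARTAN (maximal-torus) CONSTANT LINK FIELD `U(x,μ) = diag(i ↦ Ω_{i,μ})` on the fibre `ℂⁿ`. [cite: Balaban1985BackgroundPropagators, (3.3) p.391; Balaban1984PropagatorsI, (1.31) p.23] -/
def cartanLink (Ω : n → Fin (d + 1) → ℂ) : Tor K × Fin (d + 1) → Matrix n n ℂ := fun b => Matrix.diagonal fun i => Ω i b.2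

/-- Entries. [folklore] -/
theorem cartanLink_apply (Ω : n → Fin (d + 1) → ℂ) (b : Tor K × Fin (d + 1)) (i j : n) : cartanLink K Ω b i j = if i = j then Ω i b.2 else 0 := by
  rw [cartanLink, Matrix.diagonal_apply]

/-- Unit colour phases give a unitary link field. [folklore] -/
theorem cartanLink_mem_unitaryGroup [Fintype n] {Ω : n → Fin (d + 1) → ℂ} (hΩ : ∀ i μ, ‖Ω i μ‖ = 1) (b : Tor K × Fin (d + 1)) :
    cartanLink K Ω b ∈ Matrix.unitaryGroup n ℂ := by
  rw [Matrix.mem_unitaryGroup_iff, cartanLink, Matrix.star_eq_conjTranspose, Matrix.diagonal_conjTranspose, Matrix.diagonal_mul_diagonal, ← Matrix.diagonal_one]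
  congr 1
  funext i
  rw [Pi.star_apply, Complex.star_def, Complex.mul_conj', hΩ]; norm_num

variable [hK : ∀ μ, NeZero (K μ)]

/-- ★★★ **THE COLOUR SPLITTING**: `−cΔ_U + m²` at the Cartan toron is block-diagonal in colour with the abelian toron operators on the diagonal:
`covLapF K c m² (cartanLink Ω) = blockDiagonal (i ↦ toronOp K c m² (Ω i))`. [cite: Balaban1985BackgroundPropagators, (3.23) p.394; Balaban1984PropagatorsI, (1.31) p.23] -/
theorem covLapF_cartanLink_eq_blockDiagonal (c m2 : ℝ) (Ω : n → Fin (d + 1) → ℂ) :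
    covLapF K c m2 (cartanLink K Ω) = Matrix.blockDiagonal fun i => toronOp K c m2 (Ω i) := by
  ext ⟨x, i⟩ ⟨y, j⟩
  rw [Matrix.blockDiagonal_apply, covLapF_apply]
  simp only
  by_cases hij : i = j
  · subst hij
    rw [if_pos rfl, toronOp_apply, covLapF_apply]
    simp only [and_true, cartanLink_apply, Matrix.conjTranspose_apply, toronLink_apply, if_true, Complex.star_def]
  · rw [if_neg hij]
    have h1 : ∀ b, cartanLink K Ω b i j = 0 := fun b => by rw [cartanLink_apply, if_neg hij]
    have h2 : ∀ b, (cartanLink K Ω b)ᴴ i j = 0 := fun b => by rw [Matrix.conjTranspose_apply, cartanLink_apply, if_neg (Ne.symm hij), star_zero]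
    simp only [hij, and_false, if_false, h1, h2, ite_self, add_zero, Finset.sum_const_zero, mul_zero, sub_zero]

end Split

/-! ## §2 Covariance and determinant colour by colour -/
section Inverse

variable [Fintype n] [hK : ∀ μ, NeZero (K μ)]

/-- Block-diagonal inverse: if every block is invertible, `(blockDiagonal M)⁻¹ = blockDiagonal (M⁻¹)`. [folklore] -/
theorem blockDiagonal_inv_of_isUnit (M : n → Matrix (Tor K) (Tor K) ℂ) (hM : ∀ i, IsUnit (M i)) :
    (Matrix.blockDiagonal M)⁻¹ = Matrix.blockDiagonal fun i => (M i)⁻¹ := by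
  refine Matrix.inv_eq_right_inv ?_
  rw [← Matrix.blockDiagonal_mul]
  have : (fun k => M k * (M k)⁻¹) = 1 := funext fun k => Matrix.mul_nonsing_inv _ ((Matrix.isUnit_iff_isUnit_det _).mp (hM k))
  rw [this, Matrix.blockDiagonal_one]

/-- ★★ **THE CARTAN TORON COVARIANCE IS COLOUR-DIAGONAL WITH THE ABELIAN TORON COVARIANCES**: when every colour operator is invertible (e.g. unit phases and `m² > 0`, or massless
with every colour holonomy non-trivial), `(covLapF K c m² (cartanLink Ω))⁻¹ = blockDiagonal (i ↦ (toronOp K c m² (Ω i))⁻¹)`. [cite: Balaban1985BackgroundPropagators, (3.23) p.394] -/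
theorem covLapF_cartanLink_inv (c m2 : ℝ) (Ω : n → Fin (d + 1) → ℂ) (hU : ∀ i, IsUnit (toronOp K c m2 (Ω i))) :
    (covLapF K c m2 (cartanLink K Ω))⁻¹ = Matrix.blockDiagonal fun i => (toronOp K c m2 (Ω i))⁻¹ := by
  rw [covLapF_cartanLink_eq_blockDiagonal, blockDiagonal_inv_of_isUnit K _ hU]

/-- Entrywise: `G_U((x,i),(y,j)) = [i = j]·(toronOp (Ω i))⁻¹(x,y)`. [cite: Balaban1985BackgroundPropagators, (3.23) p.394] -/
theorem covLapF_cartanLink_inv_apply (c m2 : ℝ) (Ω : n → Fin (d + 1) → ℂ) (hU : ∀ i, IsUnit (toronOp K c m2 (Ω i))) (x y : Tor K) (i j : n) :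
    (covLapF K c m2 (cartanLink K Ω))⁻¹ (x, i) (y, j) = if i = j then (toronOp K c m2 (Ω i))⁻¹ x y else 0 := by
  rw [covLapF_cartanLink_inv K c m2 Ω hU, Matrix.blockDiagonal_apply]

omit [DecidableEq n] [Fintype n] in
/-- Unit phases and `m² > 0` (`c ≥ 0`) make every colour operator invertible. [folklore] -/
theorem isUnit_toronOp_colour {c m2 : ℝ} (hc : 0 ≤ c) (hm : 0 < m2) {Ω : n → Fin (d + 1) → ℂ} (hΩ : ∀ i μ, ‖Ω i μ‖ = 1) (i : n) :
    IsUnit (toronOp K c m2 (Ω i)) :=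
  (toronOp_posDef K hc hm (hΩ i)).isUnit

/-- ★ `det(−cΔ_U + m²) = Π_i det(toronOp (Ω i))` at a Cartan toron. [cite: King1986, (3.89) p.668] -/
theorem det_covLapF_cartanLink (c m2 : ℝ) (Ω : n → Fin (d + 1) → ℂ) :
    (covLapF K c m2 (cartanLink K Ω)).det = ∏ i, (toronOp K c m2 (Ω i)).det := by
  rw [covLapF_cartanLink_eq_blockDiagonal, Matrix.det_blockDiagonal]

/-- ★★ … `= Π_iΠ_q lapSymTw(φ_i, q)` for colour phases `Ω i = e^{iφ_i}` (`c ≥ 0`): the Gaussian normalisation at a Cartan toron factorises over colours and momenta.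
[cite: King1986, (3.89) p.668, (4.4) p.670] -/
theorem det_covLapF_cartanLink_eq_prod {c : ℝ} (hc : 0 ≤ c) (m2 : ℝ) (φ : n → Fin (d + 1) → ℝ) :
    (covLapF K c m2 (cartanLink K fun i => twistOf (φ i))).det = ((∏ i, ∏ q : Tor K, lapSymTw K c m2 (φ i) q : ℝ) : ℂ) := by
  rw [det_covLapF_cartanLink, Complex.ofReal_prod]
  exact Finset.prod_congr rfl fun i _ => det_toronOp_eq_ofReal_prod K hc m2 (φ i)

end Inverse

/-! ## §3 The form and the gap: the smallest colour gap -/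
section Gap

variable [Fintype n] [hK : ∀ μ, NeZero (K μ)]

/-- The form of a colour-block-diagonal matrix splits over colours: `v^*·blockDiagonal(M)·v = Σ_i (v_i)^*·M_i·v_i`, `v_i = v(·,i)`. [folklore] -/
theorem star_dotProduct_blockDiagonal_mulVec (M : n → Matrix (Tor K) (Tor K) ℂ) (v : Tor K × n → ℂ) :
    star v ⬝ᵥ (Matrix.blockDiagonal M *ᵥ v) = ∑ i, star (fun x => v (x, i)) ⬝ᵥ (M i *ᵥ fun x => v (x, i)) := by
  simp only [dotProduct, Matrix.mulVec, Pi.star_apply, Matrix.blockDiagonal_apply]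
  rw [Fintype.sum_prod_type, Finset.sum_comm]
  refine Finset.sum_congr rfl fun i _ => Finset.sum_congr rfl fun x _ => ?_
  congr 1
  rw [Fintype.sum_prod_type, Finset.sum_comm]
  rw [Finset.sum_eq_single i (fun j _ hj => by simp [Ne.symm hj]) (fun h => absurd (Finset.mem_univ i) h)]
  simp

omit [DecidableEq n] in
/-- `Σ_{(x,i)}|v(x,i)|² = Σ_iΣ_x|v(x,i)|²`. [folklore] -/
theorem sum_norm_sq_prod (v : Tor K × n → ℂ) : ∑ p, ‖v p‖ ^ 2 = ∑ i, ∑ x, ‖v (x, i)‖ ^ 2 := by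
  rw [Fintype.sum_prod_type, Finset.sum_comm]

/-- ★★★ **THE GAP OF THE CARTAN TORON IS THE SMALLEST COLOUR GAP**: for colour angles `θ_i` reduced (`|θ_{i,μ}| ≤ π`), `c ≥ 0`, any `m²` and any `λ` with `λ ≤ m² + holonomyGap(θ_i)`
for every colour, `λ·Σ_{x,i}|v(x,i)|² ≤ Re(v^*(−cΔ_U + m²)v)` (`U = diag(e^{iθ_i∕K})`). [cite: King1986, (4.35) p.674; DodziukMathai2006, §1 Cor 1.3] -/
theorem form_covLapF_cartanLink_ge {c : ℝ} (hc : 0 ≤ c) (m2 : ℝ) {θ : n → Fin (d + 1) → ℝ} (hθ : ∀ i μ, |θ i μ| ≤ Real.pi) {lam : ℝ}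
    (hlam : ∀ i, lam ≤ m2 + holonomyGap K c (θ i)) (v : Tor K × n → ℂ) :
    lam * ∑ p, ‖v p‖ ^ 2 ≤ (star v ⬝ᵥ (covLapF K c m2 (cartanLink K fun i => twistOf (redPhase K (θ i))) *ᵥ v)).re := by
  rw [covLapF_cartanLink_eq_blockDiagonal, star_dotProduct_blockDiagonal_mulVec, Complex.re_sum, sum_norm_sq_prod, Finset.mul_sum]
  refine Finset.sum_le_sum fun i _ => le_trans ?_ (form_toronOp_ge_holonomyGap K hc m2 (hθ i) fun x => v (x, i))
  exact mul_le_mul_of_nonneg_right (hlam i) (Finset.sum_nonneg fun x _ => sq_nonneg _)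

/-- ★★ **THE BOUND IS ATTAINED IN THE COLOUR OF SMALLEST GAP**: the field constant in colour `i₀` and zero in the others has `Re(v^*(−cΔ_U+m²)v) = (m² + holonomyGap(θ_{i₀}))·Σ|v|²`.
[cite: King1986, (4.35) p.674] -/
theorem form_covLapF_cartanLink_colour (c m2 : ℝ) (θ : n → Fin (d + 1) → ℝ) (i₀ : n) :
    (star (fun p : Tor K × n => if p.2 = i₀ then (1 : ℂ) else 0)
        ⬝ᵥ (covLapF K c m2 (cartanLink K fun i => twistOf (redPhase K (θ i))) *ᵥ fun p : Tor K × n => if p.2 = i₀ then (1 : ℂ) else 0)).re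
      = (m2 + holonomyGap K c (θ i₀)) * ∑ p : Tor K × n, ‖(fun p : Tor K × n => if p.2 = i₀ then (1 : ℂ) else 0) p‖ ^ 2 := by
  rw [covLapF_cartanLink_eq_blockDiagonal, star_dotProduct_blockDiagonal_mulVec, Complex.re_sum, sum_norm_sq_prod, Finset.mul_sum]
  refine Finset.sum_congr rfl fun i _ => ?_
  by_cases hi : i = i₀
  · subst hi
    simp only [if_true]
    have h := form_toronOp_one K c m2 (θ i)
    exact h
  · simp only [hi, if_false]
    have h0 : (fun _ : Tor K => (0 : ℂ)) = 0 := rfl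
    rw [h0, Matrix.mulVec_zero, dotProduct_zero, Complex.zero_re, norm_zero]
    simp

end Gap

end Summit.QuantumFields.YangMills.BalabanUVNodes.N15KingModelRung.Toron

end
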